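import Mathlib
import Summits.NavierStokesRegularity.NavierStokesRegularity.Theorems.WakeRatchetTailRatchetRelayFrozenDilation
import HarnessLib

/-!
# `WakeRatchet.TailRatchet` (stmt-NavierStokesRegularity-21808): the remaining SYMBOL ESTIMATES for the
# nonlinear step of the lacunary-`Λ` front construction (residual, quadratic and drain terms in `Y_{1/2}`)

Support file for the crux `TailRatchet` (route `WakeRatchet`; MODEL lattice ODEs of Tao 2016 §1.2, §4 —
nothing in this file is a statement about the Navier–Stokes equations, and no item is closed here).

Context (census of stmt-21808, programme "R-lac", step R-lac-3): at fixed time ratio `s ∈ [3/2, 2]` (the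
physical side `s < 2`, `δ > 0`, of the first-order law `ṡ = −ℓ_δ/τ < 0`, `…RelayDrainDirection`) the unknowns
`(h, δ)` of `G_δ(e^{t}+h, s) = 0` satisfy
`L₀h = −R_s(t) − (L_s−L₀)h − (4/s²)h(t/s)² + 4sδ·(e^{t}+h(t))(e^{st}+h(st))`... with the RESIDUAL
`R_s(t) = (4/s²)e^{2t/s} − e^{t}`, the frozen-dilation difference (`…RelayFrozenDilation`), the QUADRATIC term
and the DRAIN term.  In the weighted class `|h(ξ)| ≤ ρe^{ξ/2}` this file bounds the three remaining pieces
pointwise by multiples of `e^{t/2}`, sorry-free (`3/2 ≤ s ≤ 2`, `t ≤ 0`):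

* `residual_abs_le` — `|e^{t} − (4/s²)e^{2t/s}| ≤ 4|s−2|·e^{t/2}`;
* `quadratic_lipschitz` — `|(4/s²)(h₁(t/s)² − h₂(t/s)²)| ≤ 4ρ·d·e^{t/2}` when `|hᵢ| ≤ ρe^{ξ/2}`,
  `|h₁−h₂| ≤ d e^{ξ/2}` (needs `s ≤ 2`: `h(t/s)²` decays like `e^{t/s} ≤ e^{t/2}`);
* `drain_abs_le`, `drain_lipschitz` — `|4s(e^{t}+h(t))(e^{st}+h(st))| ≤ 8(1+ρ)²e^{t/2}` and the Lipschitz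
  bound `≤ 16(1+ρ)·d·e^{t/2}`.

With `…RelayFrozenDilation` (‖L_s−L₀‖ ≤ 16|s−2|) and the explicit bordered inverse
(`…RelayBorderedGeneral`, `…RelaySolvabilityExplicit`, `…RelayDecay`) these are all the symbol estimates of the
quasi-Newton contraction `(h,δ) ↦ (h,δ) − M⁻¹F_s(h,δ)`; what remains is the assembly (complete metric space
of pairs `(h,h')` with weights, contraction on a ball of radius `≍ |s−2|`, and the sign `δ_s > 0` for `s < 2`).

HONEST FRAMING: elementary inequalities; MODEL lattice only; the construction item and the crux stay open;
lacunary fronts do NOT refute `TailRatchet` (which needs `Λ → 1`).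
-/

noncomputable section

set_option linter.dupNamespace false

namespace Summit.NavierStokesRegularity.NavierStokesRegularity.Theorems

namespace WakeRatchetRelayNonlinearEstimates

open Set Filter Topology Real
open WakeRatchetRelayFrozenDilation

/-! ## The residual `e^{t} − (4/s²)e^{2t/s}` -/

/-- **RESIDUAL ESTIMATE**: for `3/2 ≤ s ≤ 2` and `t ≤ 0`, `|e^{t} − (4/s²)e^{2t/s}| ≤ 4|s−2|e^{t/2}`.
[cite: Tao2016AveragedNS, §1.2 (dyadic model); cell vocabulary (programme R-lac, step R-lac-3)] -/
theorem residual_abs_le {s : ℝ} (hs1 : 3 / 2 ≤ s) (hs2 : s ≤ 2) {t : ℝ} (ht : t ≤ 0) :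
    |Real.exp t - 4 / s ^ 2 * Real.exp (2 * t / s)| ≤ 4 * |s - 2| * Real.exp (t / 2) := by
  have hs0 : 0 < s := by linarith
  have h4s0 : 0 ≤ 4 / s ^ 2 := by positivity
  have h4s : 4 / s ^ 2 ≤ 16 / 9 := by
    rw [div_le_div_iff₀ (by positivity) (by norm_num)]; nlinarith
  -- `2t/s ≤ t ≤ 0`
  have h2s : 1 ≤ 2 / s := by rw [le_div_iff₀ hs0]; linarith
  have hb : 2 * t / s ≤ t := by
    have : 2 * t / s = (2 / s) * t := by ring
    rw [this]; nlinarith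
  -- coefficient mismatch
  have hcoef : |1 - 4 / s ^ 2| ≤ 2 * |s - 2| := by
    have hs2ne : s ^ 2 ≠ 0 := by positivity
    have : 1 - 4 / s ^ 2 = (s - 2) * ((s + 2) / s ^ 2) := by field_simp; ring
    rw [this, abs_mul]
    have hfac : |(s + 2) / s ^ 2| ≤ 2 := by
      rw [abs_of_pos (by positivity), div_le_iff₀ (by positivity)]; nlinarith
    calc |s - 2| * |(s + 2) / s ^ 2| ≤ |s - 2| * 2 := mul_le_mul_of_nonneg_left hfac (abs_nonneg _)
      _ = 2 * |s - 2| := by ring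
  -- exponential mismatch
  have hexp : |Real.exp t - Real.exp (2 * t / s)| ≤ Real.exp t * |t - 2 * t / s| :=
    exp_sub_exp_abs_le le_rfl hb
  have hdil : |t - 2 * t / s| ≤ 2 / 3 * |s - 2| * |t| := by
    have : t - 2 * t / s = t * ((s - 2) / s) := by field_simp
    rw [this, abs_mul, abs_div, abs_of_pos hs0]
    have : |s - 2| / s ≤ 2 / 3 * |s - 2| := by
      rw [div_le_iff₀ hs0]; nlinarith [abs_nonneg (s - 2)]
    calc |t| * (|s - 2| / s) ≤ |t| * (2 / 3 * |s - 2|) := mul_le_mul_of_nonneg_left this (abs_nonneg _)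
      _ = 2 / 3 * |s - 2| * |t| := by ring
  have hsplit : Real.exp t - 4 / s ^ 2 * Real.exp (2 * t / s) =
      (1 - 4 / s ^ 2) * Real.exp t + 4 / s ^ 2 * (Real.exp t - Real.exp (2 * t / s)) := by ring
  rw [hsplit]
  have hte : |t| * Real.exp (1 / 2 * t) ≤ 1 := by
    have := abs_mul_exp_mul_le (by norm_num : (0 : ℝ) < 1 / 2) ht
    norm_num at this ⊢; exact this
  have hhalf : Real.exp t = Real.exp (t / 2) * Real.exp (1 / 2 * t) := by rw [← Real.exp_add]; ring_nf
  have e1 : Real.exp (1 / 2 * t) ≤ 1 := Real.exp_le_one_iff.2 (by linarith)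
  have e0 : 0 < Real.exp (t / 2) := Real.exp_pos _
  calc |(1 - 4 / s ^ 2) * Real.exp t + 4 / s ^ 2 * (Real.exp t - Real.exp (2 * t / s))|
      ≤ |(1 - 4 / s ^ 2) * Real.exp t| + |4 / s ^ 2 * (Real.exp t - Real.exp (2 * t / s))| := abs_add_le _ _
    _ = |1 - 4 / s ^ 2| * Real.exp t + 4 / s ^ 2 * |Real.exp t - Real.exp (2 * t / s)| := by
        rw [abs_mul, abs_mul, abs_of_pos (Real.exp_pos _), abs_of_nonneg h4s0]
    _ ≤ 2 * |s - 2| * Real.exp t + 16 / 9 * (Real.exp t * (2 / 3 * |s - 2| * |t|)) := by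
        refine add_le_add (mul_le_mul_of_nonneg_right hcoef (Real.exp_pos _).le) ?_
        exact mul_le_mul h4s (hexp.trans (mul_le_mul_of_nonneg_left hdil (Real.exp_pos _).le))
          (abs_nonneg _) (by norm_num)
    _ = |s - 2| * Real.exp (t / 2) * (Real.exp (1 / 2 * t) * (2 + 32 / 27 * |t|)) := by
        rw [hhalf]; ring
    _ ≤ |s - 2| * Real.exp (t / 2) * 4 := by
        refine mul_le_mul_of_nonneg_left ?_ (by positivity)
        nlinarith [abs_nonneg t, Real.exp_pos (1 / 2 * t)]
    _ = 4 * |s - 2| * Real.exp (t / 2) := by ring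

/-! ## The quadratic term `(4/s²) h(t/s)²` -/

/-- **QUADRATIC LIPSCHITZ ESTIMATE**: for `3/2 ≤ s ≤ 2`, `t ≤ 0`, and `h₁, h₂` with `|hᵢ(ξ)| ≤ ρe^{ξ/2}`,
`|h₁(ξ) − h₂(ξ)| ≤ d·e^{ξ/2}` on `ξ ≤ 0`: `|(4/s²)(h₁(t/s)² − h₂(t/s)²)| ≤ 4ρ·d·e^{t/2}`.
[cite: Tao2016AveragedNS, §1.2 (dyadic model); cell vocabulary (programme R-lac, step R-lac-3)] -/
theorem quadratic_lipschitz {s : ℝ} (hs1 : 3 / 2 ≤ s) (hs2 : s ≤ 2) {h₁ h₂ : ℝ → ℝ} {ρ d : ℝ}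
    (hρ₁ : ∀ ξ : ℝ, ξ ≤ 0 → |h₁ ξ| ≤ ρ * Real.exp (ξ / 2))
    (hρ₂ : ∀ ξ : ℝ, ξ ≤ 0 → |h₂ ξ| ≤ ρ * Real.exp (ξ / 2))
    (hd : ∀ ξ : ℝ, ξ ≤ 0 → |h₁ ξ - h₂ ξ| ≤ d * Real.exp (ξ / 2)) {t : ℝ} (ht : t ≤ 0) :
    |4 / s ^ 2 * (h₁ (t / s) ^ 2 - h₂ (t / s) ^ 2)| ≤ 4 * ρ * d * Real.exp (t / 2) := by
  have hs0 : 0 < s := by linarith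
  have hts : t / s ≤ 0 := div_nonpos_of_nonpos_of_nonneg ht hs0.le
  have hρ0 : 0 ≤ ρ := by
    have := hρ₁ 0 le_rfl; rw [zero_div, Real.exp_zero, mul_one] at this; exact (abs_nonneg _).trans this
  have hd0 : 0 ≤ d := by
    have := hd 0 le_rfl; rw [zero_div, Real.exp_zero, mul_one] at this; exact (abs_nonneg _).trans this
  have h4s0 : 0 ≤ 4 / s ^ 2 := by positivity
  have h4s : 4 / s ^ 2 ≤ 2 := by
    rw [div_le_iff₀ (by positivity)]; nlinarith
  -- `e^{(t/s)/2} · e^{(t/s)/2} = e^{t/s} ≤ e^{t/2}` for `s ≤ 2`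
  have hee : Real.exp (t / s / 2) * Real.exp (t / s / 2) = Real.exp (t / s) := by
    rw [← Real.exp_add]; ring_nf
  have hes : Real.exp (t / s) ≤ Real.exp (t / 2) := by
    refine Real.exp_le_exp.2 ?_
    rw [div_le_div_iff₀ hs0 two_pos]; nlinarith
  have hfac : h₁ (t / s) ^ 2 - h₂ (t / s) ^ 2 = (h₁ (t / s) - h₂ (t / s)) * (h₁ (t / s) + h₂ (t / s)) := by
    ring
  rw [abs_mul, abs_of_nonneg h4s0, hfac, abs_mul]
  have hsum : |h₁ (t / s) + h₂ (t / s)| ≤ 2 * ρ * Real.exp (t / s / 2) := by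
    calc |h₁ (t / s) + h₂ (t / s)| ≤ |h₁ (t / s)| + |h₂ (t / s)| := abs_add_le _ _
      _ ≤ ρ * Real.exp (t / s / 2) + ρ * Real.exp (t / s / 2) := add_le_add (hρ₁ _ hts) (hρ₂ _ hts)
      _ = 2 * ρ * Real.exp (t / s / 2) := by ring
  calc 4 / s ^ 2 * (|h₁ (t / s) - h₂ (t / s)| * |h₁ (t / s) + h₂ (t / s)|)
      ≤ 2 * ((d * Real.exp (t / s / 2)) * (2 * ρ * Real.exp (t / s / 2))) :=
        mul_le_mul h4s (mul_le_mul (hd _ hts) hsum (abs_nonneg _) (by positivity))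
          (by positivity) (by norm_num)
    _ = 4 * ρ * d * (Real.exp (t / s / 2) * Real.exp (t / s / 2)) := by ring
    _ = 4 * ρ * d * Real.exp (t / s) := by rw [hee]
    _ ≤ 4 * ρ * d * Real.exp (t / 2) := mul_le_mul_of_nonneg_left hes (by positivity)

/-! ## The drain term `4s(e^{t}+h(t))(e^{st}+h(st))` -/

/-- Size of a perturbed profile: `|e^{ξ} + h(ξ)| ≤ (1+ρ)e^{ξ/2}` on `ξ ≤ 0`. [folklore] -/
theorem profile_abs_le {h : ℝ → ℝ} {ρ : ℝ} (hρ : ∀ ξ : ℝ, ξ ≤ 0 → |h ξ| ≤ ρ * Real.exp (ξ / 2))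
    {ξ : ℝ} (hξ : ξ ≤ 0) : |Real.exp ξ + h ξ| ≤ (1 + ρ) * Real.exp (ξ / 2) := by
  have he : Real.exp ξ ≤ Real.exp (ξ / 2) := Real.exp_le_exp.2 (by linarith)
  calc |Real.exp ξ + h ξ| ≤ |Real.exp ξ| + |h ξ| := abs_add_le _ _
    _ ≤ Real.exp (ξ / 2) + ρ * Real.exp (ξ / 2) := by
        rw [abs_of_pos (Real.exp_pos _)]; exact add_le_add he (hρ ξ hξ)
    _ = (1 + ρ) * Real.exp (ξ / 2) := by ring

/-- **DRAIN TERM SIZE**: for `3/2 ≤ s ≤ 2`, `t ≤ 0`, `|h| ≤ ρe^{ξ/2}`: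
`|4s(e^{t}+h(t))(e^{st}+h(st))| ≤ 8(1+ρ)²e^{t/2}`. [folklore] -/
theorem drain_abs_le {s : ℝ} (hs1 : 3 / 2 ≤ s) (hs2 : s ≤ 2) {h : ℝ → ℝ} {ρ : ℝ}
    (hρ : ∀ ξ : ℝ, ξ ≤ 0 → |h ξ| ≤ ρ * Real.exp (ξ / 2)) {t : ℝ} (ht : t ≤ 0) :
    |4 * s * ((Real.exp t + h t) * (Real.exp (s * t) + h (s * t)))| ≤
      8 * (1 + ρ) ^ 2 * Real.exp (t / 2) := by
  have hs0 : 0 < s := by linarith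
  have hst : s * t ≤ 0 := mul_nonpos_of_nonneg_of_nonpos hs0.le ht
  have hρ0 : 0 ≤ ρ := by
    have := hρ 0 le_rfl; rw [zero_div, Real.exp_zero, mul_one] at this; exact (abs_nonneg _).trans this
  have h1 := profile_abs_le hρ ht
  have h2 := profile_abs_le hρ hst
  have he2 : Real.exp (s * t / 2) ≤ 1 := Real.exp_le_one_iff.2 (by nlinarith)
  have heq : |4 * s * ((Real.exp t + h t) * (Real.exp (s * t) + h (s * t)))| =
      4 * s * (|Real.exp t + h t| * |Real.exp (s * t) + h (s * t)|) := by
    rw [abs_mul, abs_mul, abs_mul, abs_of_pos hs0, abs_of_pos (by norm_num : (0 : ℝ) < 4)]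
  rw [heq]
  calc 4 * s * (|Real.exp t + h t| * |Real.exp (s * t) + h (s * t)|)
      ≤ 4 * 2 * (((1 + ρ) * Real.exp (t / 2)) * ((1 + ρ) * Real.exp (s * t / 2))) :=
        mul_le_mul (by linarith) (mul_le_mul h1 h2 (abs_nonneg _) (by positivity))
          (by positivity) (by norm_num)
    _ = 8 * (1 + ρ) ^ 2 * Real.exp (t / 2) * Real.exp (s * t / 2) := by ring
    _ ≤ 8 * (1 + ρ) ^ 2 * Real.exp (t / 2) * 1 := mul_le_mul_of_nonneg_left he2 (by positivity)
    _ = 8 * (1 + ρ) ^ 2 * Real.exp (t / 2) := mul_one _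

/-- **DRAIN TERM LIPSCHITZ ESTIMATE**: for `3/2 ≤ s ≤ 2`, `t ≤ 0`, `|hᵢ| ≤ ρe^{ξ/2}`, `|h₁−h₂| ≤ de^{ξ/2}`:
`|4s[(e^{t}+h₁(t))(e^{st}+h₁(st)) − (e^{t}+h₂(t))(e^{st}+h₂(st))]| ≤ 16(1+ρ)·d·e^{t/2}`. [folklore] -/
theorem drain_lipschitz {s : ℝ} (hs1 : 3 / 2 ≤ s) (hs2 : s ≤ 2) {h₁ h₂ : ℝ → ℝ} {ρ d : ℝ}
    (hρ₁ : ∀ ξ : ℝ, ξ ≤ 0 → |h₁ ξ| ≤ ρ * Real.exp (ξ / 2))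
    (hρ₂ : ∀ ξ : ℝ, ξ ≤ 0 → |h₂ ξ| ≤ ρ * Real.exp (ξ / 2))
    (hd : ∀ ξ : ℝ, ξ ≤ 0 → |h₁ ξ - h₂ ξ| ≤ d * Real.exp (ξ / 2)) {t : ℝ} (ht : t ≤ 0) :
    |4 * s * ((Real.exp t + h₁ t) * (Real.exp (s * t) + h₁ (s * t)) -
        (Real.exp t + h₂ t) * (Real.exp (s * t) + h₂ (s * t)))| ≤ 16 * (1 + ρ) * d * Real.exp (t / 2) := by
  have hs0 : 0 < s := by linarith
  have hst : s * t ≤ 0 := mul_nonpos_of_nonneg_of_nonpos hs0.le ht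
  have hρ0 : 0 ≤ ρ := by
    have := hρ₁ 0 le_rfl; rw [zero_div, Real.exp_zero, mul_one] at this; exact (abs_nonneg _).trans this
  have hd0 : 0 ≤ d := by
    have := hd 0 le_rfl; rw [zero_div, Real.exp_zero, mul_one] at this; exact (abs_nonneg _).trans this
  have hA := profile_abs_le hρ₂ hst   -- |e^{st} + h₂(st)| ≤ (1+ρ)e^{st/2}
  have hB := profile_abs_le hρ₁ ht    -- |e^{t} + h₁(t)| ≤ (1+ρ)e^{t/2}
  have he1 : Real.exp (s * t / 2) ≤ 1 := Real.exp_le_one_iff.2 (by nlinarith)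
  have he2 : Real.exp (t / 2) ≤ 1 := Real.exp_le_one_iff.2 (by linarith)
  -- algebraic split: (a₁b₁ − a₂b₂) = (a₁−a₂)b₂ + a₁(b₁−b₂)
  have hsplit : (Real.exp t + h₁ t) * (Real.exp (s * t) + h₁ (s * t)) -
      (Real.exp t + h₂ t) * (Real.exp (s * t) + h₂ (s * t)) =
      (h₁ t - h₂ t) * (Real.exp (s * t) + h₂ (s * t)) +
        (Real.exp t + h₁ t) * (h₁ (s * t) - h₂ (s * t)) := by ring
  rw [hsplit]
  have heq : |4 * s * ((h₁ t - h₂ t) * (Real.exp (s * t) + h₂ (s * t)) +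
      (Real.exp t + h₁ t) * (h₁ (s * t) - h₂ (s * t)))| =
      4 * s * |(h₁ t - h₂ t) * (Real.exp (s * t) + h₂ (s * t)) +
        (Real.exp t + h₁ t) * (h₁ (s * t) - h₂ (s * t))| := by
    rw [abs_mul, abs_mul, abs_of_pos hs0, abs_of_pos (by norm_num : (0 : ℝ) < 4)]
  rw [heq]
  have hT1 : |(h₁ t - h₂ t) * (Real.exp (s * t) + h₂ (s * t))| ≤ d * (1 + ρ) * Real.exp (t / 2) := by
    rw [abs_mul]
    calc |h₁ t - h₂ t| * |Real.exp (s * t) + h₂ (s * t)|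
        ≤ (d * Real.exp (t / 2)) * ((1 + ρ) * Real.exp (s * t / 2)) :=
          mul_le_mul (hd t ht) hA (abs_nonneg _) (by positivity)
      _ = d * (1 + ρ) * Real.exp (t / 2) * Real.exp (s * t / 2) := by ring
      _ ≤ d * (1 + ρ) * Real.exp (t / 2) * 1 := mul_le_mul_of_nonneg_left he1 (by positivity)
      _ = d * (1 + ρ) * Real.exp (t / 2) := mul_one _
  have hT2 : |(Real.exp t + h₁ t) * (h₁ (s * t) - h₂ (s * t))| ≤ d * (1 + ρ) * Real.exp (t / 2) := by
    rw [abs_mul]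
    have hst2 : Real.exp (s * t / 2) ≤ 1 := he1
    calc |Real.exp t + h₁ t| * |h₁ (s * t) - h₂ (s * t)|
        ≤ ((1 + ρ) * Real.exp (t / 2)) * (d * Real.exp (s * t / 2)) :=
          mul_le_mul hB (hd _ hst) (abs_nonneg _) (by positivity)
      _ = d * (1 + ρ) * Real.exp (t / 2) * Real.exp (s * t / 2) := by ring
      _ ≤ d * (1 + ρ) * Real.exp (t / 2) * 1 := mul_le_mul_of_nonneg_left hst2 (by positivity)
      _ = d * (1 + ρ) * Real.exp (t / 2) := mul_one _
  calc 4 * s * |(h₁ t - h₂ t) * (Real.exp (s * t) + h₂ (s * t)) +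
        (Real.exp t + h₁ t) * (h₁ (s * t) - h₂ (s * t))|
      ≤ 4 * 2 * (d * (1 + ρ) * Real.exp (t / 2) + d * (1 + ρ) * Real.exp (t / 2)) :=
        mul_le_mul (by linarith) ((abs_add_le _ _).trans (add_le_add hT1 hT2)) (abs_nonneg _) (by norm_num)
    _ = 16 * (1 + ρ) * d * Real.exp (t / 2) := by ring

end WakeRatchetRelayNonlinearEstimates

end Summit.NavierStokesRegularity.NavierStokesRegularity.Theorems

end
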